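import Literature.Probability.Percolation.TriHalfAnnulus
import Literature.Probability.Percolation.TriLowestCrossingProb
import Literature.Probability.Percolation.TriPathCrossings
import Literature.Probability.Percolation.TriThetaHalf
import HarnessLib

/-!
# RSW for the inner half-annulus: an open crossing of `intDom m` is not certain

Topic: Probability / Percolation; family `crit-perc` (critical site percolation on `𝕋`,
`P = P_{1/2} = triSitePercolation half`). A brick of the discharge of
`Literature.Probability.Percolation.Nolin2008_twoArm_separation` (Nolin 2008, Thm. 11
[arXiv 0711.4948: Thm. 10], `j = 2`; `ArmSeparation.lean`), INTERNAL extremities. In the proof of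
Nolin's Lemma 15 [arXiv Lemma 14] the number of disjoint crossings of the exploration region is
controlled by "the probability of crossing this domain is less than some `1 - δ'` (by RSW)"
(Nolin 2008, (4.16)), which with BK gives `P(at least h crossings) ≤ (1 - δ')^h` ((4.17); in the
tree: `JDomain.real_lowestSeq_ne_none_le_pow`, `TriLowestCrossingProb.lean`). This file proves
(4.16) for the exploration domain of internal extremities on the inner side `1` of `∂Λ_m`, the
half-annulus `HalfAnnulus.intDom m` of `TriHalfAnnulus.lean`:

* `HalfAnnulus.intBlock m k` — the blocking event at scale `k` (`8k ≤ m ≤ 16k`): five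
  parallelograms of aspect ratio at most `24`, crossed the long way, forming a "C" from below the
  inner side `6` of `∂Λ_m`, around the lower corner `(m, -m)` of the side `1` outside `Λ_m`, up
  along `{m + k ≤ x₀ ≤ m + 2k}`, and back over the upper corner `(m, 0)` down to the inner side `2`;
* `HalfAnnulus.exists_isIntBt_isIntTp_path` — **deterministic core**: if a set of sites `χ`
  realises `intBlock m k`, then `χ ∩ HA(m)` contains a `𝕋`-path from the lower reference arc
  `IsIntBt` to the upper reference arc `IsIntTp` (the crossings are glued where they cross common
  parallelograms, `PathIn.tri_crossings_meet`; the glued path is cut below the row `x₁ = -m`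
  (`PathIn.exists_slab_crossing`) and stopped at its first site of `Λ_m ∩ {x₁ ≥ 0}`
  (`PathIn.exit`), which lies on the side `2` since the hexagonal norm moves by at most one along
  an edge);
* `HalfAnnulus.not_mem_crossEvent_intDom` — applied to the closed sites `χ = ωᶜ`: such a closed
  path is incompatible with every open crossing of `intDom m` (`HalfAnnulus.intDom_cutProp`);
* `HalfAnnulus.pow_five_le_real_compl_preimage_intBlock` — `P(ωᶜ ∈ intBlock m k) ≥ c₂₄⁵` by the
  colour symmetry of `P_{1/2}`, RSW at aspect ratio `24` and Harris' inequality;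
* `HalfAnnulus.real_crossEvent_intDom_le` — **(4.16)**: `P((intDom m).crossEvent) ≤ 1 - c₂₄⁵`
  for `m ≥ 8` (scale `k = ⌊m/8⌋`), and `HalfAnnulus.real_lowestSeq_intDom_ne_none_le` —
  **(4.17)**: `P(lowestSeq T ≠ none) ≤ (1 - c₂₄⁵)^{T+1}`;
  `HalfAnnulus.exists_real_crossEvent_intDom_le` packages the constant (`tri_rsw_half_holds`).

## References

* P. Nolin, *Near-critical percolation in two dimensions*, Electron. J. Probab. 13 (2008), §4.4,
  proof of Lemma 15 [arXiv 0711.4948: Lemma 14, (4.16)–(4.17)]. [Nolin2008]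
* H. Kesten, *Scaling relations for 2D-percolation*, Comm. Math. Phys. 109 (1987), Lemma 2. [Kesten1987]
* G. Grimmett, *Percolation*, 2nd ed. (1999), §11.7 (RSW and FKG chaining). [GrimmettPercolation1999]

Tree: `HalfAnnulus.intDom`, `intDom_cutProp`, `haSet`, `IsIntBt`, `IsIntTp`, `triNorm_mk`
(`TriHalfAnnulus.lean`); `JDomain.crossEvent`, `JDomain.real_lowestSeq_ne_none_le_pow`
(`TriLowestCrossingProb.lean`); `PathIn.tri_crossings_meet(')` (`TriCrossingsMeet.lean`);
`PathIn.exists_slab_crossing`, `PathIn.exists_support`, `PathIn.exit` (`TriPathCrossings.lean`,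
`TriRSWChaining.lean`, `SitePaths.lean`); `triHCross`, `triVCross`, `determinedBy_triHCross/VCross`,
`isUpperSet_triHCross/VCross`, `triSitePercolation_real_triHCross/VCross`, `triLRCrossingProb_anti_width`,
`determinedBy_compl_mem` (`TriRSWChaining.lean`); `sitePercolation_harris`
(`SitePercolationMeasure.lean`); `sitePercolation_real_preimage_compl` (`TriHexLemma.lean`);
`tri_rsw_half_holds` (`TriThetaHalf.lean`); `triNorm_le_triNorm_add_one_of_adj'` (`ArmEventsProofs.lean`).
-/

noncomputable section

open MeasureTheory Set

namespace Literature.Probability.Percolation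

open LatticeModels

namespace HalfAnnulus

variable {m k : ℕ}

/-! ### The blocking event -/

/-- **The blocking "C" around the inner side `1` at scale `k`**: the five long-way crossings
(i) vertical of `[m-2k, m-k] × [-m-2k, -m+k]` (through the inner side `6`), (ii) horizontal of
`[m-2k, m+2k] × [-m-2k, -m-k]` (under the corner `(m, -m)`), (iii) vertical of
`[m+k, m+2k] × [-m-2k, 6k]` (outside the side `1`), (iv) horizontal of `[m-4k, m+2k] × [5k, 6k]`
(over the corner `(m, 0)`), (v) vertical of `[m-4k, m-3k] × [3k, 6k]` (through the inner side `2`).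
Realised by the closed sites it forbids every open crossing of `intDom m` (Nolin 2008, (4.16)). [cite: Nolin2008, §4.4 Lemma 15 (proof) (arXiv 0711.4948: Lemma 14, (4.16))] -/
def intBlock (m k : ℕ) : Set (SiteConfig (Site 2)) :=
  triVCross ((m : ℤ) - 2 * k) (-(m : ℤ) - 2 * k) k (3 * k) ∩
    triHCross ((m : ℤ) - 2 * k) (-(m : ℤ) - 2 * k) (4 * k) k ∩
    triVCross ((m : ℤ) + k) (-(m : ℤ) - 2 * k) k (m + 8 * k) ∩
    triHCross ((m : ℤ) - 4 * k) (5 * k) (6 * k) k ∩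
    triVCross ((m : ℤ) - 4 * k) (3 * k) k (3 * k)

/-- The sites of the five parallelograms of `intBlock`. [folklore] -/
def intBlockFinset (m k : ℕ) : Finset (Site 2) :=
  triStripFinset ((m : ℤ) - 2 * k) (-(m : ℤ) - 2 * k) k (3 * k) ∪
    triStripFinset ((m : ℤ) - 2 * k) (-(m : ℤ) - 2 * k) (4 * k) k ∪
    triStripFinset ((m : ℤ) + k) (-(m : ℤ) - 2 * k) k (m + 8 * k) ∪
    triStripFinset ((m : ℤ) - 4 * k) (5 * k) (6 * k) k ∪
    triStripFinset ((m : ℤ) - 4 * k) (3 * k) k (3 * k)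

/-- `intBlock` is increasing. [folklore] -/
theorem isUpperSet_intBlock (m k : ℕ) : IsUpperSet (intBlock m k) :=
  ((((isUpperSet_triVCross _ _ _ _).inter (isUpperSet_triHCross _ _ _ _)).inter
    (isUpperSet_triVCross _ _ _ _)).inter (isUpperSet_triHCross _ _ _ _)).inter (isUpperSet_triVCross _ _ _ _)

/-- `intBlock` is determined by the sites of its five parallelograms. [folklore] -/
theorem determinedBy_intBlock (m k : ℕ) : DeterminedBy (intBlock m k) ↑(intBlockFinset m k) := by
  have c1 : (↑(triStripFinset ((m : ℤ) - 2 * k) (-(m : ℤ) - 2 * k) k (3 * k)) : Set (Site 2)) ⊆ ↑(intBlockFinset m k) :=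
    Finset.coe_subset.2 (Finset.subset_union_left.trans (Finset.subset_union_left.trans
      (Finset.subset_union_left.trans Finset.subset_union_left)))
  have c2 : (↑(triStripFinset ((m : ℤ) - 2 * k) (-(m : ℤ) - 2 * k) (4 * k) k) : Set (Site 2)) ⊆ ↑(intBlockFinset m k) :=
    Finset.coe_subset.2 (Finset.subset_union_right.trans (Finset.subset_union_left.trans
      (Finset.subset_union_left.trans Finset.subset_union_left)))
  have c3 : (↑(triStripFinset ((m : ℤ) + k) (-(m : ℤ) - 2 * k) k (m + 8 * k)) : Set (Site 2)) ⊆ ↑(intBlockFinset m k) :=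
    Finset.coe_subset.2 (Finset.subset_union_right.trans (Finset.subset_union_left.trans Finset.subset_union_left))
  have c4 : (↑(triStripFinset ((m : ℤ) - 4 * k) (5 * k) (6 * k) k) : Set (Site 2)) ⊆ ↑(intBlockFinset m k) :=
    Finset.coe_subset.2 (Finset.subset_union_right.trans Finset.subset_union_left)
  have c5 : (↑(triStripFinset ((m : ℤ) - 4 * k) (3 * k) k (3 * k)) : Set (Site 2)) ⊆ ↑(intBlockFinset m k) :=
    Finset.coe_subset.2 Finset.subset_union_right
  exact (((((determinedBy_triVCross _ _ _ _).mono c1).inter ((determinedBy_triHCross _ _ _ _).mono c2)).inter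
    ((determinedBy_triVCross _ _ _ _).mono c3)).inter ((determinedBy_triHCross _ _ _ _).mono c4)).inter
    ((determinedBy_triVCross _ _ _ _).mono c5)

/-! ### Deterministic core: a blocking path from the lower to the upper reference arc -/

/-- Coordinate bounds of the five parallelograms of `intBlock m k`, as linear inequalities (the
case analysis along the glued path only uses these). [folklore] -/
def InIntBlockBox (m k : ℕ) (v : Site 2) : Prop :=
  ((m : ℤ) - 2 * k ≤ v 0 ∧ v 0 ≤ (m : ℤ) - k ∧ -(m : ℤ) - 2 * k ≤ v 1 ∧ v 1 ≤ -(m : ℤ)) ∨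
    ((m : ℤ) - 2 * k ≤ v 0 ∧ v 0 ≤ (m : ℤ) + 2 * k ∧ -(m : ℤ) - 2 * k ≤ v 1 ∧ v 1 ≤ -(m : ℤ) - k) ∨
    ((m : ℤ) + k ≤ v 0 ∧ v 0 ≤ (m : ℤ) + 2 * k ∧ -(m : ℤ) - 2 * k ≤ v 1 ∧ v 1 ≤ 6 * k) ∨
    ((m : ℤ) - 4 * k ≤ v 0 ∧ v 0 ≤ (m : ℤ) + 2 * k ∧ 5 * (k : ℤ) ≤ v 1 ∧ v 1 ≤ 6 * k) ∨
    ((m : ℤ) - 4 * k ≤ v 0 ∧ v 0 ≤ (m : ℤ) - 3 * k ∧ 3 * (k : ℤ) ≤ v 1 ∧ v 1 ≤ 6 * k)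

/-- Enlarging a coordinate box. [folklore] -/
theorem box_mono {L R B T L' R' B' T' : ℤ} {v : Site 2} (h : L ≤ v 0 ∧ v 0 ≤ R ∧ B ≤ v 1 ∧ v 1 ≤ T)
    (hL : L' ≤ L) (hR : R ≤ R') (hB : B' ≤ B) (hT : T ≤ T') : L' ≤ v 0 ∧ v 0 ≤ R' ∧ B' ≤ v 1 ∧ v 1 ≤ T' :=
  ⟨hL.trans h.1, h.2.1.trans hR, hB.trans h.2.2.1, h.2.2.2.trans hT⟩

/-- Sites of the five parallelograms off `Λ_m ∩ {x₁ ≥ 0}` lie in the half-annulus `HA(m)`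
(`k ≥ 1`, `8k ≤ m`). [folklore] -/
theorem mem_haSet_of_inIntBlockBox (hk : 1 ≤ k) (hkm : 8 * k ≤ m) {v : Site 2} (hv : InIntBlockBox m k v)
    (hR : ¬ (triNorm v ≤ m ∧ 0 ≤ v 1)) : v ∈ haSet m := by
  have hk' : (1 : ℤ) ≤ k := by exact_mod_cast hk
  have hkm' : 8 * (k : ℤ) ≤ m := by exact_mod_cast hkm
  rw [mem_haSet]
  rcases hv with h | h | h | h | h
  · exact ⟨by omega, le_triNorm_iff_lin.2 (by omega), triNorm_le_iff_lin.2 (by omega)⟩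
  · exact ⟨by omega, le_triNorm_iff_lin.2 (by omega), triNorm_le_iff_lin.2 (by omega)⟩
  · exact ⟨by omega, le_triNorm_iff_lin.2 (by omega), triNorm_le_iff_lin.2 (by omega)⟩
  · exact ⟨by omega, le_triNorm_iff_lin.2 (by omega), triNorm_le_iff_lin.2 (by omega)⟩
  · exact ⟨by omega, by omega, triNorm_le_iff_lin.2 (by omega)⟩

/-- **The stopping site is on the inner side `2`.** A site `q` of the five parallelograms with
`|q|_𝕋 ≤ m`, `q₁ ≥ 0`, adjacent to a site `p` off `Λ_m ∩ {x₁ ≥ 0}`, lies on the upper reference arc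
`IsIntTp` (in fact `q₀ + q₁ = m`, `q₁ ≥ 3k`): it can only belong to the fifth parallelogram, and
`|p|_𝕋 > m` forces `|q|_𝕋 = m` (the norm moves by at most one along an edge). [folklore] -/
theorem isIntTp_of_inIntBlockBox (hk : 1 ≤ k) (hkm : 8 * k ≤ m) {p q : Site 2} (hq : InIntBlockBox m k q)
    (hqN : triNorm q ≤ m) (hq1 : 0 ≤ q 1) (hpq : triGraph.Adj p q) (hp : ¬ (triNorm p ≤ m ∧ 0 ≤ p 1)) :
    IsIntTp m q ∧ q ∈ haSet m := by
  have hk' : (1 : ℤ) ≤ k := by exact_mod_cast hk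
  have hkm' : 8 * (k : ℤ) ≤ m := by exact_mod_cast hkm
  have hn := triNorm_le_triNorm_add_one_of_adj' hpq
  have hc1 := triGraph_adj_coord hpq 1
  have hqle := triNorm_le_iff_lin.1 hqN
  rcases hq with h | h | h | h | h
  · exfalso; omega
  · exfalso; omega
  · exfalso; omega
  · exfalso; omega
  · have hqm : (m : ℤ) ≤ triNorm q := by omega
    have hge := le_triNorm_iff_lin.1 hqm
    have hsum : q 0 + q 1 = m := by omega
    exact ⟨⟨le_antisymm hqN hqm, Or.inl ⟨hq1, hsum⟩⟩, mem_haSet.2 ⟨by omega, hqm, by omega⟩⟩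

/-- A site of the first parallelogram on the row `x₁ = -m` lies on the lower reference arc
`IsIntBt` (its norm is `m`). [folklore] -/
theorem isIntBt_of_box (hkm : 8 * k ≤ m) {b : Site 2}
    (h : (m : ℤ) - 2 * k ≤ b 0 ∧ b 0 ≤ (m : ℤ) - k ∧ -(m : ℤ) - 2 * k ≤ b 1 ∧ b 1 ≤ -(m : ℤ)) (hb : b 1 = -(m : ℤ)) :
    IsIntBt m b := by
  have hkm' : 8 * (k : ℤ) ≤ m := by exact_mod_cast hkm
  exact ⟨le_antisymm (triNorm_le_iff_lin.2 (by omega)) (le_triNorm_iff_lin.2 (by omega)), Or.inl hb⟩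

/-- A site of the fifth parallelogram on its bottom row `x₁ = 3k` lies in `Λ_m ∩ {x₁ ≥ 0}`. [folklore] -/
theorem triNorm_le_of_box (hkm : 8 * k ≤ m) {x : Site 2}
    (h : (m : ℤ) - 4 * k ≤ x 0 ∧ x 0 ≤ (m : ℤ) - 3 * k ∧ 3 * (k : ℤ) ≤ x 1 ∧ x 1 ≤ 6 * k) (hx : x 1 = 3 * k) :
    triNorm x ≤ m ∧ 0 ≤ x 1 := by
  have hkm' : 8 * (k : ℤ) ≤ m := by exact_mod_cast hkm
  exact ⟨triNorm_le_iff_lin.2 (by omega), by omega⟩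

/-- **Stopping a path of the five parallelograms at `Λ_m ∩ {x₁ ≥ 0}`.** A `𝕋`-path inside a set
`U` of sites of the five parallelograms, from a site `b` of the row `x₁ = -m` to a site `x` of
`Λ_m ∩ {x₁ ≥ 0}`, has an initial segment inside `HA(m) ∩ U` ending (after one more edge) at a site
of the upper reference arc `IsIntTp` (`PathIn.exit` and the two lemmas above). [folklore] -/
theorem exists_isIntTp_stop (hk : 1 ≤ k) (hkm : 8 * k ≤ m) {U : Set (Site 2)} (hU : ∀ v ∈ U, InIntBlockBox m k v)
    {b x : Site 2} (hb : b 1 = -(m : ℤ)) (hx : triNorm x ≤ m ∧ 0 ≤ x 1) (hpath : PathIn triGraph U b x) :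
    ∃ q, IsIntTp m q ∧ PathIn triGraph (haSet m ∩ U) b q := by
  have hbR : b ∈ {v : Site 2 | ¬ (triNorm v ≤ m ∧ 0 ≤ v 1)} := by
    have hk' : (1 : ℤ) ≤ k := by exact_mod_cast hk
    have hkm' : 8 * (k : ℤ) ≤ m := by exact_mod_cast hkm
    simp only [Set.mem_setOf_eq]
    omega
  have hxR : x ∉ {v : Site 2 | ¬ (triNorm v ≤ m ∧ 0 ≤ v 1)} := by
    simp only [Set.mem_setOf_eq, not_not]
    exact hx
  obtain ⟨p, q, hpR, hqR, hqU, hpq, hpre⟩ := hpath.exit hbR hxR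
  simp only [Set.mem_setOf_eq, not_not] at hqR
  have hq := isIntTp_of_inIntBlockBox hk hkm (hU q hqU) hqR.1 hqR.2 hpq hpR
  refine ⟨q, hq.1, (hpre.mono ?_).tail hpq ⟨hq.2, hqU⟩⟩
  rintro v ⟨hvR, hvU⟩
  exact ⟨mem_haSet_of_inIntBlockBox hk hkm (hU v hvU) hvR, hvU⟩

/-- **The glued "C" contains a path of `HA(m)` from `IsIntBt` to `IsIntTp`.** If the set of sites
`χ` crosses the five parallelograms of `intBlock m k` (`k ≥ 1`, `8k ≤ m`), then `χ ∩ HA(m)`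
contains a `𝕋`-path from a site of the inner side `6` (`x₁ = -m`) to a site of the inner side `2`
(`x₀ + x₁ = m`, `x₁ ≥ 0`): consecutive crossings meet (`PathIn.tri_crossings_meet`), the first one
is cut at the row `x₁ = -m` (`PathIn.exists_slab_crossing`), and the glued path is stopped at its
first site of `Λ_m ∩ {x₁ ≥ 0}` (`exists_isIntTp_stop`). [cite: Nolin2008, §4.4 Lemma 15 (proof) (arXiv 0711.4948: Lemma 14, (4.16))] -/
theorem exists_isIntBt_isIntTp_path (hk : 1 ≤ k) (hkm : 8 * k ≤ m) {χ : Set (Site 2)} (hχ : χ ∈ intBlock m k) :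
    ∃ s e, IsIntBt m s ∧ IsIntTp m e ∧ PathIn triGraph (haSet m ∩ χ) s e := by
  -- constants
  have cst : (-(m : ℤ) - 2 * k ≤ -(m : ℤ)) ∧ ((m : ℤ) - k ≤ (m : ℤ) + 2 * k) ∧ (-(m : ℤ) - k ≤ -(m : ℤ)) ∧
      (-(m : ℤ) - k ≤ 6 * k) ∧ ((m : ℤ) - 2 * k ≤ (m : ℤ) + k) ∧ ((m : ℤ) - 4 * k ≤ (m : ℤ) + k) ∧
      (-(m : ℤ) - 2 * k ≤ 5 * k) ∧ ((3 : ℤ) * k ≤ 5 * k) ∧ ((m : ℤ) - 3 * k ≤ (m : ℤ) + 2 * k) ∧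
      ((m : ℤ) - 4 * k ≤ (m : ℤ) - 2 * k) := by omega
  obtain ⟨c0, c1, c2, c3, c4, c5, c6, c7, c8, c9⟩ := cst
  obtain ⟨⟨⟨⟨⟨x1, y1, hx1, hy1, P1⟩, ⟨x2, y2, hx2, hy2, P2⟩⟩, ⟨x3, y3, hx3, hy3, P3⟩⟩, ⟨x4, y4, hx4, hy4, P4⟩⟩,
    ⟨x5, y5, hx5, hy5, P5⟩⟩ := hχ
  -- (1) the first crossing, cut below the row `x₁ = -m`
  obtain ⟨a1, b1, ha1, hb1, P1'⟩ := P1.exists_slab_crossing 1 (L := -(m : ℤ) - 2 * k) (R := -(m : ℤ)) c0 hx1.le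
    (by rw [hy1]; push_cast; linarith)
  -- (2) tight supports and their coordinate bounds
  obtain ⟨S1, hS1, Q1, T1⟩ := P1'.exists_support
  obtain ⟨S2, hS2, Q2, T2⟩ := P2.exists_support
  obtain ⟨S3, hS3, Q3, T3⟩ := P3.exists_support
  obtain ⟨S4, hS4, Q4, T4⟩ := P4.exists_support
  obtain ⟨S5, hS5, Q5, T5⟩ := P5.exists_support
  have bd1 : ∀ v ∈ S1, ((m : ℤ) - 2 * k ≤ v 0 ∧ v 0 ≤ (m : ℤ) - k ∧ -(m : ℤ) - 2 * k ≤ v 1 ∧ v 1 ≤ -(m : ℤ)) ∧ v ∈ χ := by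
    intro v hv
    obtain ⟨⟨hvB, hvχ⟩, hvs⟩ := hS1 hv
    rw [mem_triStrip] at hvB
    exact ⟨⟨hvB.1, hvB.2.1.trans_eq (by ring), hvs.1, hvs.2⟩, hvχ⟩
  have bd2 : ∀ v ∈ S2, ((m : ℤ) - 2 * k ≤ v 0 ∧ v 0 ≤ (m : ℤ) + 2 * k ∧ -(m : ℤ) - 2 * k ≤ v 1 ∧ v 1 ≤ -(m : ℤ) - k) ∧ v ∈ χ := by
    intro v hv
    obtain ⟨hvB, hvχ⟩ := hS2 hv
    rw [mem_triStrip] at hvB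
    exact ⟨⟨hvB.1, hvB.2.1.trans_eq (by push_cast; ring), hvB.2.2.1, hvB.2.2.2.trans_eq (by ring)⟩, hvχ⟩
  have bd3 : ∀ v ∈ S3, ((m : ℤ) + k ≤ v 0 ∧ v 0 ≤ (m : ℤ) + 2 * k ∧ -(m : ℤ) - 2 * k ≤ v 1 ∧ v 1 ≤ 6 * k) ∧ v ∈ χ := by
    intro v hv
    obtain ⟨hvB, hvχ⟩ := hS3 hv
    rw [mem_triStrip] at hvB
    exact ⟨⟨hvB.1, hvB.2.1.trans_eq (by ring), hvB.2.2.1, hvB.2.2.2.trans_eq (by push_cast; ring)⟩, hvχ⟩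
  have bd4 : ∀ v ∈ S4, ((m : ℤ) - 4 * k ≤ v 0 ∧ v 0 ≤ (m : ℤ) + 2 * k ∧ 5 * (k : ℤ) ≤ v 1 ∧ v 1 ≤ 6 * k) ∧ v ∈ χ := by
    intro v hv
    obtain ⟨hvB, hvχ⟩ := hS4 hv
    rw [mem_triStrip] at hvB
    exact ⟨⟨hvB.1, hvB.2.1.trans_eq (by push_cast; ring), hvB.2.2.1, hvB.2.2.2.trans_eq (by ring)⟩, hvχ⟩
  have bd5 : ∀ v ∈ S5, ((m : ℤ) - 4 * k ≤ v 0 ∧ v 0 ≤ (m : ℤ) - 3 * k ∧ 3 * (k : ℤ) ≤ v 1 ∧ v 1 ≤ 6 * k) ∧ v ∈ χ := by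
    intro v hv
    obtain ⟨hvB, hvχ⟩ := hS5 hv
    rw [mem_triStrip] at hvB
    exact ⟨⟨hvB.1, hvB.2.1.trans_eq (by ring), hvB.2.2.1, hvB.2.2.2.trans_eq (by push_cast; ring)⟩, hvχ⟩
  -- (3) consecutive crossings meet
  have hy2' : y2 0 = (m : ℤ) + 2 * k := hy2.trans (by push_cast; ring)
  have hy3' : y3 1 = 6 * (k : ℤ) := hy3.trans (by push_cast; ring)
  have hy4' : y4 0 = (m : ℤ) + 2 * k := hy4.trans (by push_cast; ring)
  have hy5' : y5 1 = 6 * (k : ℤ) := hy5.trans (by push_cast; ring)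
  have hA12 : ∀ v ∈ S1, (m : ℤ) - 2 * k ≤ v 0 ∧ v 0 ≤ (m : ℤ) + 2 * k ∧ -(m : ℤ) - 2 * k ≤ v 1 ∧ v 1 ≤ -(m : ℤ) :=
    fun v hv => box_mono (bd1 v hv).1 le_rfl c1 le_rfl le_rfl
  have hA21 : ∀ v ∈ S2, (m : ℤ) - 2 * k ≤ v 0 ∧ v 0 ≤ (m : ℤ) + 2 * k ∧ -(m : ℤ) - 2 * k ≤ v 1 ∧ v 1 ≤ -(m : ℤ) :=
    fun v hv => box_mono (bd2 v hv).1 le_rfl le_rfl le_rfl c2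
  have hA23 : ∀ v ∈ S2, (m : ℤ) - 2 * k ≤ v 0 ∧ v 0 ≤ (m : ℤ) + 2 * k ∧ -(m : ℤ) - 2 * k ≤ v 1 ∧ v 1 ≤ 6 * k :=
    fun v hv => box_mono (bd2 v hv).1 le_rfl le_rfl le_rfl c3
  have hA32 : ∀ v ∈ S3, (m : ℤ) - 2 * k ≤ v 0 ∧ v 0 ≤ (m : ℤ) + 2 * k ∧ -(m : ℤ) - 2 * k ≤ v 1 ∧ v 1 ≤ 6 * k :=
    fun v hv => box_mono (bd3 v hv).1 c4 le_rfl le_rfl le_rfl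
  have hA34 : ∀ v ∈ S3, (m : ℤ) - 4 * k ≤ v 0 ∧ v 0 ≤ (m : ℤ) + 2 * k ∧ -(m : ℤ) - 2 * k ≤ v 1 ∧ v 1 ≤ 6 * k :=
    fun v hv => box_mono (bd3 v hv).1 c5 le_rfl le_rfl le_rfl
  have hA43 : ∀ v ∈ S4, (m : ℤ) - 4 * k ≤ v 0 ∧ v 0 ≤ (m : ℤ) + 2 * k ∧ -(m : ℤ) - 2 * k ≤ v 1 ∧ v 1 ≤ 6 * k :=
    fun v hv => box_mono (bd4 v hv).1 le_rfl le_rfl c6 le_rfl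
  have hA45 : ∀ v ∈ S4, (m : ℤ) - 4 * k ≤ v 0 ∧ v 0 ≤ (m : ℤ) + 2 * k ∧ 3 * (k : ℤ) ≤ v 1 ∧ v 1 ≤ 6 * k :=
    fun v hv => box_mono (bd4 v hv).1 le_rfl le_rfl c7 le_rfl
  have hA54 : ∀ v ∈ S5, (m : ℤ) - 4 * k ≤ v 0 ∧ v 0 ≤ (m : ℤ) + 2 * k ∧ 3 * (k : ℤ) ≤ v 1 ∧ v 1 ≤ 6 * k :=
    fun v hv => box_mono (bd5 v hv).1 le_rfl c8 le_rfl le_rfl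
  obtain ⟨p12, hp12a, hp12b⟩ := PathIn.tri_crossings_meet' hA12 hA21 Q1 ha1 hb1 Q2 hx2 hy2'
  obtain ⟨p23, hp23a, hp23b⟩ := PathIn.tri_crossings_meet hA23 hA32 Q2 hx2 hy2' Q3 hx3 hy3'
  obtain ⟨p34, hp34a, hp34b⟩ := PathIn.tri_crossings_meet' hA34 hA43 Q3 hx3 hy3' Q4 hx4 hy4'
  obtain ⟨p45, hp45a, hp45b⟩ := PathIn.tri_crossings_meet hA45 hA54 Q4 hx4 hy4' Q5 hx5 hy5'
  -- (4) the union of the supports is connected: a path from `b1` (row `-m`) to `x5` (row `3k`)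
  obtain ⟨U, i1, i2, i3, i4, i5, hUcase⟩ : ∃ U : Set (Site 2), S1 ⊆ U ∧ S2 ⊆ U ∧ S3 ⊆ U ∧ S4 ⊆ U ∧ S5 ⊆ U ∧
      ∀ v ∈ U, v ∈ S1 ∨ v ∈ S2 ∨ v ∈ S3 ∨ v ∈ S4 ∨ v ∈ S5 :=
    ⟨S1 ∪ S2 ∪ S3 ∪ S4 ∪ S5, fun v hv => Or.inl (Or.inl (Or.inl (Or.inl hv))),
      fun v hv => Or.inl (Or.inl (Or.inl (Or.inr hv))), fun v hv => Or.inl (Or.inl (Or.inr hv)),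
      fun v hv => Or.inl (Or.inr hv), fun v hv => Or.inr hv, fun v hv => by
        rcases hv with (((hv | hv) | hv) | hv) | hv
        exacts [Or.inl hv, Or.inr (Or.inl hv), Or.inr (Or.inr (Or.inl hv)), Or.inr (Or.inr (Or.inr (Or.inl hv))),
          Or.inr (Or.inr (Or.inr (Or.inr hv)))]⟩
  have hpath : PathIn triGraph U b1 x5 :=
    ((((T1 b1 Q1.right_mem).symm.trans (T1 p12 hp12a)).mono i1).trans
      ((((T2 p12 hp12b).symm.trans (T2 p23 hp23a)).mono i2).trans
      ((((T3 p23 hp23b).symm.trans (T3 p34 hp34a)).mono i3).trans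
      ((((T4 p34 hp34b).symm.trans (T4 p45 hp45a)).mono i4).trans
      ((T5 p45 hp45b).symm.mono i5)))))
  have hUχ : ∀ v ∈ U, v ∈ χ := by
    intro v hv
    rcases hUcase v hv with hv | hv | hv | hv | hv
    exacts [(bd1 v hv).2, (bd2 v hv).2, (bd3 v hv).2, (bd4 v hv).2, (bd5 v hv).2]
  have hUbox : ∀ v ∈ U, InIntBlockBox m k v := by
    intro v hv
    rcases hUcase v hv with hv | hv | hv | hv | hv
    exacts [Or.inl (bd1 v hv).1, Or.inr (Or.inl (bd2 v hv).1), Or.inr (Or.inr (Or.inl (bd3 v hv).1)),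
      Or.inr (Or.inr (Or.inr (Or.inl (bd4 v hv).1))), Or.inr (Or.inr (Or.inr (Or.inr (bd5 v hv).1)))]
  -- (5) stop at the first site of `Λ_m ∩ {x₁ ≥ 0}`
  obtain ⟨q, hTp, hqpath⟩ := exists_isIntTp_stop hk hkm hUbox hb1 (triNorm_le_of_box hkm (bd5 x5 Q5.left_mem).1 hx5) hpath
  exact ⟨b1, q, isIntBt_of_box hkm (bd1 b1 Q1.right_mem).1 hb1, hTp, hqpath.mono fun v hv => ⟨hv.1, hUχ v hv.2⟩⟩

/-- **A closed "C" forbids every open crossing of the inner half-annulus**: if the closed sites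
of `ω` realise `intBlock m k` (`k ≥ 1`, `8k ≤ m`), then `ω ∉ (intDom m).crossEvent` — the closed
`IsIntBt–IsIntTp` path of `exists_isIntBt_isIntTp_path` avoids the open crossing and contradicts
`HalfAnnulus.intDom_cutProp`. [cite: Nolin2008, §4.4 Lemma 15 (proof) (arXiv 0711.4948: Lemma 14, (4.16))] -/
theorem not_mem_crossEvent_intDom (hk : 1 ≤ k) (hkm : 8 * k ≤ m) {ω : SiteConfig (Site 2)}
    (hω : ωᶜ ∈ intBlock m k) : ω ∉ (intDom m).crossEvent := by
  rintro ⟨c, z, hc, hcω⟩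
  have hm : 5 ≤ m := by omega
  obtain ⟨s, e, hs, he, hp⟩ := exists_isIntBt_isIntTp_path hk hkm hω
  have hsD : s ∈ haFin m := by rw [← Finset.mem_coe, coe_haFin]; exact hp.left_mem.1
  have heD : e ∈ haFin m := by rw [← Finset.mem_coe, coe_haFin]; exact hp.right_mem.1
  refine intDom_cutProp hm hc s (Finset.mem_union_left _ (mem_intDom_Bt.2 ⟨hsD, hs⟩)) e
    (Finset.mem_union_left _ (mem_intDom_Tp.2 ⟨heD, he⟩)) ?_
  rw [coe_intDom_D_sdiff]
  exact hp.mono fun v hv => ⟨hv.1, fun hvc => hv.2 (hcω hvc)⟩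

/-! ### Probability -/

/-- **RSW and Harris for the closed "C"**: if `c ≤ P_{1/2}(long-way crossing of [0, 24n] × [0, n])`
for all `n ≥ 1`, then `P_{1/2}(ωᶜ ∈ intBlock m k) ≥ c⁵` for `k ≥ 1` and `m ≤ 16k` (colour symmetry
of `P_{1/2}`, the five parallelograms have aspect ratio at most `24`, Harris' inequality). [cite: Nolin2008, §4.4 Lemma 15 (proof) (arXiv 0711.4948: Lemma 14, (4.16))] -/
theorem pow_five_le_real_compl_preimage_intBlock {c : ℝ}
    (hrsw : ∀ n : ℕ, 1 ≤ ⌊(24 : ℝ) * n⌋₊ → c ≤ triLRCrossingProb half ⌊(24 : ℝ) * n⌋₊ n)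
    (hc : 0 ≤ c) (hk : 1 ≤ k) (hm : m ≤ 16 * k) :
    c ^ 5 ≤ (triSitePercolation half).real (compl ⁻¹' intBlock m k) := by
  have hfl : ⌊(24 : ℝ) * (k : ℕ)⌋₊ = 24 * k := by
    have : (24 : ℝ) * (k : ℕ) = ((24 * k : ℕ) : ℝ) := by push_cast; ring
    rw [this, Nat.floor_natCast]
  have hcw : ∀ L : ℕ, L ≤ 24 * k → c ≤ triLRCrossingProb half L k := fun L hL => by
    have h := hrsw k (by rw [hfl]; omega)
    rw [hfl] at h
    exact h.trans (triLRCrossingProb_anti_width half hL k)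
  -- the five events, their supports, monotonicity and probabilities
  set E1 := triVCross ((m : ℤ) - 2 * k) (-(m : ℤ) - 2 * k) k (3 * k) with hE1
  set E2 := triHCross ((m : ℤ) - 2 * k) (-(m : ℤ) - 2 * k) (4 * k) k with hE2
  set E3 := triVCross ((m : ℤ) + k) (-(m : ℤ) - 2 * k) k (m + 8 * k) with hE3
  set E4 := triHCross ((m : ℤ) - 4 * k) (5 * k) (6 * k) k with hE4
  set E5 := triVCross ((m : ℤ) - 4 * k) (3 * k) k (3 * k) with hE5
  set F := intBlockFinset m k with hF
  have c1 : (↑(triStripFinset ((m : ℤ) - 2 * k) (-(m : ℤ) - 2 * k) k (3 * k)) : Set (Site 2)) ⊆ ↑F :=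
    Finset.coe_subset.2 (Finset.subset_union_left.trans (Finset.subset_union_left.trans
      (Finset.subset_union_left.trans Finset.subset_union_left)))
  have c2 : (↑(triStripFinset ((m : ℤ) - 2 * k) (-(m : ℤ) - 2 * k) (4 * k) k) : Set (Site 2)) ⊆ ↑F :=
    Finset.coe_subset.2 (Finset.subset_union_right.trans (Finset.subset_union_left.trans
      (Finset.subset_union_left.trans Finset.subset_union_left)))
  have c3 : (↑(triStripFinset ((m : ℤ) + k) (-(m : ℤ) - 2 * k) k (m + 8 * k)) : Set (Site 2)) ⊆ ↑F :=
    Finset.coe_subset.2 (Finset.subset_union_right.trans (Finset.subset_union_left.trans Finset.subset_union_left))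
  have c4 : (↑(triStripFinset ((m : ℤ) - 4 * k) (5 * k) (6 * k) k) : Set (Site 2)) ⊆ ↑F :=
    Finset.coe_subset.2 (Finset.subset_union_right.trans Finset.subset_union_left)
  have c5 : (↑(triStripFinset ((m : ℤ) - 4 * k) (3 * k) k (3 * k)) : Set (Site 2)) ⊆ ↑F :=
    Finset.coe_subset.2 (Finset.subset_union_right)
  have d1 : DeterminedBy E1 ↑F := (determinedBy_triVCross _ _ _ _).mono c1
  have d2 : DeterminedBy E2 ↑F := (determinedBy_triHCross _ _ _ _).mono c2
  have d3 : DeterminedBy E3 ↑F := (determinedBy_triVCross _ _ _ _).mono c3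
  have d4 : DeterminedBy E4 ↑F := (determinedBy_triHCross _ _ _ _).mono c4
  have d5 : DeterminedBy E5 ↑F := (determinedBy_triVCross _ _ _ _).mono c5
  have u1 : IsUpperSet E1 := isUpperSet_triVCross _ _ _ _
  have u2 : IsUpperSet E2 := isUpperSet_triHCross _ _ _ _
  have u3 : IsUpperSet E3 := isUpperSet_triVCross _ _ _ _
  have u4 : IsUpperSet E4 := isUpperSet_triHCross _ _ _ _
  have u5 : IsUpperSet E5 := isUpperSet_triVCross _ _ _ _
  have e1 : c ≤ (triSitePercolation half).real E1 := by
    rw [hE1, triSitePercolation_real_triVCross]; exact hcw _ (by omega)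
  have e2 : c ≤ (triSitePercolation half).real E2 := by
    rw [hE2, triSitePercolation_real_triHCross]; exact hcw _ (by omega)
  have e3 : c ≤ (triSitePercolation half).real E3 := by
    rw [hE3, triSitePercolation_real_triVCross]; exact hcw _ (by omega)
  have e4 : c ≤ (triSitePercolation half).real E4 := by
    rw [hE4, triSitePercolation_real_triHCross]; exact hcw _ (by omega)
  have e5 : c ≤ (triSitePercolation half).real E5 := by
    rw [hE5, triSitePercolation_real_triVCross]; exact hcw _ (by omega)
  have hblock : intBlock m k = E1 ∩ E2 ∩ E3 ∩ E4 ∩ E5 := rfl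
  unfold triSitePercolation at e1 e2 e3 e4 e5 ⊢
  rw [sitePercolation_real_preimage_compl, symm_half, hblock]
  have h12 := sitePercolation_harris half d1 d2 u1 u2
  have h123 := sitePercolation_harris half (d1.inter d2) d3 (u1.inter u2) u3
  have h1234 := sitePercolation_harris half ((d1.inter d2).inter d3) d4 ((u1.inter u2).inter u3) u4
  have h12345 := sitePercolation_harris half (((d1.inter d2).inter d3).inter d4) d5
    (((u1.inter u2).inter u3).inter u4) u5
  set μ := sitePercolation (Site 2) half with hμ
  calc c ^ 5 = c * c * c * c * c := by ring
    _ ≤ μ.real E1 * μ.real E2 * μ.real E3 * μ.real E4 * μ.real E5 := by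
        have := mul_le_mul e1 e2 hc measureReal_nonneg
        have := mul_le_mul this e3 hc (mul_nonneg measureReal_nonneg measureReal_nonneg)
        have := mul_le_mul this e4 hc (mul_nonneg (mul_nonneg measureReal_nonneg measureReal_nonneg) measureReal_nonneg)
        exact mul_le_mul this e5 hc (mul_nonneg (mul_nonneg (mul_nonneg measureReal_nonneg measureReal_nonneg)
          measureReal_nonneg) measureReal_nonneg)
    _ ≤ μ.real (E1 ∩ E2) * μ.real E3 * μ.real E4 * μ.real E5 :=
        mul_le_mul_of_nonneg_right (mul_le_mul_of_nonneg_right (mul_le_mul_of_nonneg_right h12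
          measureReal_nonneg) measureReal_nonneg) measureReal_nonneg
    _ ≤ μ.real (E1 ∩ E2 ∩ E3) * μ.real E4 * μ.real E5 :=
        mul_le_mul_of_nonneg_right (mul_le_mul_of_nonneg_right h123 measureReal_nonneg) measureReal_nonneg
    _ ≤ μ.real (E1 ∩ E2 ∩ E3 ∩ E4) * μ.real E5 := mul_le_mul_of_nonneg_right h1234 measureReal_nonneg
    _ ≤ μ.real (E1 ∩ E2 ∩ E3 ∩ E4 ∩ E5) := h12345

/-- **Nolin's (4.16) for the inner half-annulus**: if `c ≤ P_{1/2}(long-way crossing of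
[0, 24n] × [0, n])` for all `n ≥ 1`, then `P_{1/2}((intDom m).crossEvent) ≤ 1 - c⁵` for every
`m ≥ 8` (take `k = ⌊m/8⌋`, so that `8k ≤ m ≤ 16k`). [cite: Nolin2008, §4.4 Lemma 15 (proof) (arXiv 0711.4948: Lemma 14, (4.16))] -/
theorem real_crossEvent_intDom_le {c : ℝ}
    (hrsw : ∀ n : ℕ, 1 ≤ ⌊(24 : ℝ) * n⌋₊ → c ≤ triLRCrossingProb half ⌊(24 : ℝ) * n⌋₊ n) (hc : 0 ≤ c)
    (hm : 8 ≤ m) :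
    (triSitePercolation half).real (intDom m).crossEvent ≤ 1 - c ^ 5 := by
  set k := m / 8 with hk
  have hk1 : 1 ≤ k := by omega
  have hkm : 8 * k ≤ m := by omega
  have hmk : m ≤ 16 * k := by omega
  have hmeas : MeasurableSet (compl ⁻¹' intBlock m k) :=
    (determinedBy_compl_mem (determinedBy_intBlock m k)).measurableSet_of_finset
  have hsub : (intDom m).crossEvent ⊆ (compl ⁻¹' intBlock m k)ᶜ := fun ω hω hωV =>
    not_mem_crossEvent_intDom hk1 hkm hωV hω
  have h5 := pow_five_le_real_compl_preimage_intBlock hrsw hc hk1 hmk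
  calc (triSitePercolation half).real (intDom m).crossEvent
      ≤ (triSitePercolation half).real (compl ⁻¹' intBlock m k)ᶜ := measureReal_mono hsub
    _ = 1 - (triSitePercolation half).real (compl ⁻¹' intBlock m k) := by
        rw [measureReal_compl hmeas, probReal_univ]
    _ ≤ 1 - c ^ 5 := by linarith

/-- **Nolin's (4.17) for the inner half-annulus**: `P(lowestSeq T ≠ none) ≤ (1 - c⁵)^{T+1}` for
the exploration sequence of `intDom m`, `m ≥ 8` ("combined with the BK inequality, this implies
that the probability of observing at least `h` crossings is less than `(1 - δ')^h`";
`JDomain.real_lowestSeq_ne_none_le_pow` and `real_crossEvent_intDom_le`). [cite: Nolin2008, §4.4 Lemma 15 (proof) (arXiv 0711.4948: Lemma 14, (4.17))] -/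
theorem real_lowestSeq_intDom_ne_none_le {c : ℝ}
    (hrsw : ∀ n : ℕ, 1 ≤ ⌊(24 : ℝ) * n⌋₊ → c ≤ triLRCrossingProb half ⌊(24 : ℝ) * n⌋₊ n) (hc : 0 ≤ c)
    (hm : 8 ≤ m) (T : ℕ) :
    (triSitePercolation half).real {ω | (intDom m).lowestSeq ω T ≠ none} ≤ (1 - c ^ 5) ^ (T + 1) := by
  have h1 := JDomain.real_lowestSeq_ne_none_le_pow (intDom_cutProp (m := m) (by omega)) half T
  have h2 := real_crossEvent_intDom_le hrsw hc hm
  unfold triSitePercolation at h2 ⊢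
  exact h1.trans (pow_le_pow_left₀ measureReal_nonneg h2 _)

/-- **The constant exists** (`tri_rsw_half_holds` at aspect ratio `24`): there is `δ' > 0` with
`P_{1/2}((intDom m).crossEvent) ≤ 1 - δ'` and `P_{1/2}(lowestSeq T ≠ none) ≤ (1 - δ')^{T+1}` for
all `m ≥ 8` and all `T`. [cite: Nolin2008, §4.4 Lemma 15 (proof) (arXiv 0711.4948: Lemma 14, (4.16)–(4.17))] -/
theorem exists_real_crossEvent_intDom_le :
    ∃ δ : ℝ, 0 < δ ∧ ∀ m : ℕ, 8 ≤ m →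
      (triSitePercolation half).real (intDom m).crossEvent ≤ 1 - δ ∧
        ∀ T : ℕ, (triSitePercolation half).real {ω | (intDom m).lowestSeq ω T ≠ none} ≤ (1 - δ) ^ (T + 1) := by
  obtain ⟨c, hc, hrsw⟩ := tri_rsw_half_holds 24 (by norm_num)
  exact ⟨c ^ 5, by positivity, fun m hm => ⟨real_crossEvent_intDom_le (fun n hn => (hrsw n hn).1) hc.le hm,
    fun T => real_lowestSeq_intDom_ne_none_le (fun n hn => (hrsw n hn).1) hc.le hm T⟩⟩

end HalfAnnulus

end Literature.Probability.Percolation
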